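import Summits.Ventures.PercRepro.RankLevelSetTightLayer

/-!
# PercRepro — [WORKAROUND COPY, (um)(35)(2)–(4): the primed (`_S`) re-statement of RankLevelSetAvgMult, whose landed copy (the citation of record) has no olean yet; every declaration carries the `_S` suffix; imports only modules WITH oleans]
# THE MULTIPLICITY LEMMA OF THE AVERAGED CHARGING (night-1, gen 9 session 4; dossier §19.12 (d))

On the tight layer, for two members `A`, `A′` of `U(p,q)` and the flat `F := cl(E ∖ A)` (of rank `q`): the complement
`E ∖ A′` has at most `q − |F ∖ (E ∖ A)|` elements outside `F` — `p = r(A′) ≤ r(F) + |A′ ∖ F| = q + (p − k_A) − |(E∖A′) ∖ F|`.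
This is what bounds the number of members `A′` with `E ∖ A′ ⊆ T` for the dependent supply sets `T ⊇ E ∖ A` of part 2 of
the charging (`m̄(s₁,s₂)` of §19.12 (d)).

* `ncard_compl_eq_of_mem_Uset_S` — `|E ∖ A| = q` for `A ∈ U(p,q)` (tight layer);
* `ncard_sdiff_closure_add_excess_le_S` — the lemma: `|(E∖A′) ∖ cl(E∖A)| + |cl(E∖A) ∖ (E∖A)| ≤ q`.

Axioms: standard.
-/
open scoped Matroid

namespace PercRepro

open Set

variable {α : Type} (M : Matroid α) [M.Finite]

/-- On the tight layer a member of `U(p,q)` has exactly `p` elements and its complement exactly `q`. -/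
lemma ncard_compl_eq_of_mem_Uset_S {p q : ℕ} (hE : M.E.ncard = p + q) {A : Set α} (hA : A ∈ Uset M p q) :
    A.ncard = p ∧ (M.E \ A).ncard = q := by
  have hEfin : M.E.Finite := M.set_finite M.E
  have hg := Uset_subset_goodImg M hE hA
  obtain ⟨hgi, -⟩ := hg
  rw [mem_indImg_iff] at hgi
  obtain ⟨hAE, -, hcard⟩ := hgi
  have hAfin : A.Finite := hEfin.subset hAE
  have hAcard : A.ncard = p := by
    rw [← hAfin.cast_ncard_eq] at hcard
    exact_mod_cast hcard
  refine ⟨hAcard, ?_⟩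
  have hsum := ncard_sdiff_add_ncard_of_subset hAE hEfin
  omega

/-- **THE MULTIPLICITY LEMMA**: for `A, A′ ∈ U(p,q)` on the tight layer, with `F = cl(E ∖ A)`,
`|(E ∖ A′) ∖ F| + |F ∖ (E ∖ A)| ≤ q`. -/
theorem ncard_sdiff_closure_add_excess_le_S {p q : ℕ} (hE : M.E.ncard = p + q) {A A' : Set α}
    (hA : A ∈ Uset M p q) (hA' : A' ∈ Uset M p q) :
    ((M.E \ A') \ M.closure (M.E \ A)).ncard + (M.closure (M.E \ A) \ (M.E \ A)).ncard ≤ q := by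
  have hEfin : M.E.Finite := M.set_finite M.E
  set F := M.closure (M.E \ A) with hF
  have hFE : F ⊆ M.E := M.closure_subset_ground _
  have hsubF : M.E \ A ⊆ F := M.subset_closure _ sdiff_subset
  have hrF : M.eRk F = (q : ℕ∞) := by
    rw [hF, M.eRk_closure_eq]
    exact hA.2.2
  have hA'E : A' ⊆ M.E := hA'.1
  have hrA' : M.eRk A' = (p : ℕ∞) := hA'.2.1
  obtain ⟨-, hAc_card⟩ := ncard_compl_eq_of_mem_Uset_S M hE hA
  -- `p = r(A′) ≤ r(F) + |A′ ∖ F|`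
  have h1 : M.eRk A' ≤ M.eRk F + (A' \ F).encard := by
    calc M.eRk A' ≤ M.eRk (F ∪ (A' \ F)) := by
          apply M.eRk_mono
          intro x hx
          by_cases h : x ∈ F
          · exact Or.inl h
          · exact Or.inr ⟨hx, h⟩
      _ ≤ M.eRk F + (A' \ F).encard := M.eRk_union_le_eRk_add_encard F (A' \ F)
  have hA'Ffin : (A' \ F).Finite := hEfin.subset (sdiff_subset.trans hA'E)
  have h1' : p ≤ q + (A' \ F).ncard := by
    rw [hrA', hrF, ← hA'Ffin.cast_ncard_eq] at h1
    exact_mod_cast h1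
  -- `|A′ ∖ F| + |(E ∖ A′) ∖ F| = |E ∖ F|`
  have hsplit : (A' \ F).ncard + ((M.E \ A') \ F).ncard = (M.E \ F).ncard := by
    have hunion : M.E \ F = (A' \ F) ∪ ((M.E \ A') \ F) := by
      ext x
      constructor
      · rintro ⟨hxE, hxF⟩
        by_cases h : x ∈ A'
        · exact Or.inl ⟨h, hxF⟩
        · exact Or.inr ⟨⟨hxE, h⟩, hxF⟩
      · rintro (⟨hxA, hxF⟩ | ⟨⟨hxE, -⟩, hxF⟩)
        · exact ⟨hA'E hxA, hxF⟩
        · exact ⟨hxE, hxF⟩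
    rw [hunion, ncard_union_eq ?_ hA'Ffin (hEfin.subset (sdiff_subset.trans sdiff_subset))]
    rw [Set.disjoint_left]
    rintro x ⟨hxA, -⟩ ⟨⟨-, hxA'⟩, -⟩
    exact hxA' hxA
  have hEF : (M.E \ F).ncard + F.ncard = M.E.ncard := ncard_sdiff_add_ncard_of_subset hFE hEfin
  have hFfin : F.Finite := hEfin.subset hFE
  have hFk : (F \ (M.E \ A)).ncard + (M.E \ A).ncard = F.ncard :=
    ncard_sdiff_add_ncard_of_subset hsubF hFfin
  omega

end PercRepro
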